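import Literature.MathematicalPhysics.QuantumFieldTheory.Balaban1983to89.B6MainResultsOneLevel
import Literature.MathematicalPhysics.QuantumFieldTheory.Balaban1983to89.B6Prop27OneScaleTorus
import Literature.MathematicalPhysics.QuantumFieldTheory.Balaban1983to89.B6Lemma24Printed
import Literature.MathematicalPhysics.QuantumFieldTheory.Balaban1983to89.B6Prop25OneLevelV1
import Literature.MathematicalPhysics.QuantumFieldTheory.Balaban1983to89.DagBinding

/-!
# `Balaban1983to89.B6BlockParamOneLevel` — [B6] the DAG leaf `b6` in PARAMETER form (`DagBinding.B6BlockParam` = Lemma 2.1 with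
# ∃ c₁(α) ∧ Props. 2.2, 2.3 ∧ Lemma 2.4 ∧ Props. 2.5, 2.6, 2.7 ∧ Cor. 2.8, verbatim) ON THE ONE-LEVEL BLOCK OF `B6MainResultsOneLevel`:
# SEVEN of its eight conjuncts are theorems there and here — Lemma 2.1-param, Prop. 2.3 (the genuine `(Q′G′²Q′*)⁻¹` kernel of [4]
# (1.45)), Lemma 2.4 (printed constant), Props. 2.5, 2.6, 2.7 (the genuine `(QGQ*)⁻¹` kernel), Cor. 2.8 — so that
# **`B6BlockParam (knitBlock d L a δ₀ Gp) ↔ Prop22Printed (blockGeo d L a) Gp`**: on these model carriers the leaf reduces to its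
# Proposition 2.2 conjunct alone (the scalar `G′ = Δ′_a⁻¹` seen through (2.67), whose functionals live on another geometry of record)

FRAMING (verbatim cell line):
statement-level skeleton of published theorems with citation tags; proofs where landed; nothing here is a claim about the Yang–Mills mass gap

Sources (cell `lit-balaban`, HOME `run/shared/lean/pub/lit-balaban/`; seat **r03 gen 11** = the B6 fold owner, own lane under the
free-target protocol G.5-34(d); SKELETON row **B6.Main** — decl column `B6.StatedBlock` / `B6.MainResults` / `DagBinding.B6BlockParam`;
inputs BY NAME: B6.Main (`B6MainResultsOneLevel.mainResults_oneLevel`, p312355, this seat), B6.Prop2.7 (p01 g5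
`B6Prop27OneScaleTorus.abs_qgqInvKer_le`), B6.Prop2.3 ∕ B5.Eq1.45 (`B5Torus145Decay.inverse145_torusKernelM_decay_torusMetric`, the engine of
p01 g5 `B6Prop23OneScaleTorus.prop23Printed_oneScaleTorus`), B6.Lem2.4 (b06 `B6Lemma24Printed.lemma24Printed_carrier` — the PRINTED constant
1/(12d²), every L), B6.Prop2.5 (r03 g10 `B6Prop25OneLevelV1.prop25Printed_oneLevel`, p310856), B5 row sums (r02
`B5RowSumsP12Lattice.rowSum_univ_distSite_le`)): T. Bałaban, *Propagators and renormalization transformations for lattice gauge theories.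
II*, Commun. Math. Phys. **96** (1984) 223–250 [`Balaban1984PropagatorsII`, "B6"], Lemma 2.1 p. 234, Prop. 2.3 (2.87) p. 238, Prop. 2.7
(2.149) p. 249, pp. 223–250 (the eight statements); PDF held `paper:balaban1984-cmp96-propagators-rt-ii` (journal page = PDF page + 222;
pp. 225–228, 234, 248–249 re-read on the text layer this session); T. Bałaban, *… I*, Commun. Math. Phys. **95** (1984) 17–40
[`Balaban1984PropagatorsI`, "[4]"], (1.45) p. 26.

## WHAT IS PRINTED (verbatim up to notation) AND HOW IT IS READ HERE

Lemma 2.1 (p. 234): «For the numbers α, 0 < α < 1, c₁(α) = 12c₀^d(½α), and RM satisfying (2.59) we have e^{−αδ₀d(y,y′)} ≤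
e^{−αδ₀RM max{|j−j′|−1,0}}, y ∈ Λ_j, y′ ∈ Λ_{j′}, (2.60)  sup_{y∈𝔅} Σ_{y′∈𝔅} e^{−αδ₀d(y,y′)} ≤ c₁(α), (2.61)».  ON ONE LEVEL (all sites at
scale K, `R = M = 1`, (2.1)–(2.2) void — the block geometry `B6MainResultsOneLevel.blockGeo` = r03 g9's `geoFam` «with sites replaced by
bonds» (p. 248)): (2.60) is VOID (its right-hand side is e⁰ = 1; `ineq260_block`), and (2.61) is a unit-lattice row sum over the bonds of
`T₁^{(K)}`, `Σ_c e^{−αδ₀|y − c₋|₁} ≤ d·K_d(αδ₀)` uniformly in the volume (`ineq261With_block`, from r02's `rowSum_univ_distSite_le` and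
`|·|_∞ ≤ |·|₁`); hence the PARAMETER form `DagBinding.B6Lemma21Param` (∃ c₁(α), uniform over the family) holds for the one-level block
with `c₁(α) = d·K_d(αδ₀)` (`lemma21Param_oneLevel`; constant ours — the printed c₁(α) is refuted as typed for d ≥ 3 on multi-level
geometries, cell G-A11-1, and is not claimed).  Proposition 2.3 (p. 238): «An inverse of the operator Q′G′²Q′* … satisfies the estimate
|(Q′G′²Q′*)⁻¹(y, y′)| ≤ O(1)(L^jη)^{−4}(L^{j′}η)^{−d}e^{−½δ₁d(y,y′)} … (2.87)»: on the block family the kernel is the GENUINE one-scale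
`(Q′_KG′_K²Q′_K*)⁻¹`, `G′_K = (Δ^η + aQ′_K*Q′_K)⁻¹` (the block's coefficient `a`; the print's Prop. 2.2 takes a = 1), given by [4]'s
(1.45) torus kernel `B5Torus145Decay.torusKernel145M` of the representative difference (= p01's `B5QGGQ145Bounds.kerRe`, the inverse matrix of
`Q′_KG′_K²Q′_K*`, `B6Prop23OneScaleTorus.torusCinv_eq_inv`), read through the base point of the bond (`blockCinv`, `cinvFun`); its estimate is
the b05 engine `inverse145_torusKernelM_decay_torusMetric` BY NAME (`abs_cinvFun_le_gen`, `prop23Printed_block`: δ₁ = 2κ/d², O(1) =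
c⁻¹Λ_κ).  Proposition 2.7 (p. 249): «The operator (QGQ*)⁻¹ … satisfies the bound |(QGQ*)⁻¹(b, b′)| ≤ O(1)(L^jη)^{−2}(L^{j′}η)^{−d}
e^{−½δ₄d(b,b′)}, b ∈ Λ_j, b′ ∈ Λ_{j′}. (2.149)»: on the block family the kernel is the GENUINE `(Q_KΔ_a⁻¹Q_K*)⁻¹` of THE SAME
`G = Δ_a⁻¹ = (B5DeltaA169.DeltaA (nP P) (MP P) a)⁻¹` as the block's G- and H-functionals (`B6MainResultsOneLevel.blockH_operator_eq`), and the
estimate is p01's `abs_qgqInvKer_le` BY NAME through a dimension-generic wrapper (`abs_qgqInv_re_le_gen`: period vector `MP P`, `n = L^K =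
nP P`), `δ₄ = rateH d/d`, `O(1) = a + C₂₇(d−1)` (`blockQinv`, `prop27Printed_block`).  Lemma 2.4 (p. 245, the PRINTED constant 1/(12d²)) and
Proposition 2.5 (p. 246) have carriers of their own in `B6.BlockData` (`tree`, `loc`); the knit block takes the concrete ones of record —
all finite `Λ′ ⊂ Lℤ^d` with `B6Lemma24Carrier.carrier` (b06's `lemma24Printed_carrier`, every `d ≥ 2`, `L ≥ 1`) and r03 g10's
`B6Prop25OneLevelV1.loc` (`prop25Printed_oneLevel`).  Proposition 2.6 and Corollary 2.8 are `B6MainResultsOneLevel.prop26Printed_block` /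
`cor28Printed_block` (p312355).

## WHAT THIS FILE PROVES (kernel-checked; 0 sorry; no new `def … : Prop`; every input USED BY NAME, not re-proved)

* §1 `distSite_le_dist1`, `rowSum_bond_le` (bond row sums ≤ |B|·K_D(κ), uniform in the torus); `ineq260_block`, `ineq261With_block`,
  **`lemma21Param_oneLevel (hδ : 0 < δ₀) : B6Lemma21Param (oneLevelBlock d L a δ₀ Gp Cinv Qinv J tree K loc)`** (any carriers).
* §2 `abs_qgqInv_re_le_gen` (p01's (2.149) estimate for any positive period vector), `blockQinv` (the genuine kernel on member `i`),
  **`prop27Printed_block (hd : 1 ≤ d) (ha : 0 < a) : B6.Prop27Printed d (blockGeo d L a) (blockQinv d L a)`**.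
* §3 `cinvFun`, `cinvFun_eq_kerRe` (= p01's `kerRe` entries, `rfl`), `abs_cinvFun_le_gen` ([4] (1.45) kernel estimate for any positive
  period vector), `blockCinv`,
  **`prop23Printed_block (hd : 1 ≤ d) (ha : 0 < a) : B6.Prop23Printed d (blockGeo d L a) (blockCinv d L a)`**.
* §4 `TreeIdx`, **`knitBlock d L a δ₀ Gp`** (the one-level block with `Cinv := blockCinv`, `Qinv := blockQinv`, the tree-gauge carriers and
  the local operators of record; `Gp` a parameter), `lemma24Printed_knit`, `prop25Printed_knit`, the bundle `seven_of_eight_knit`, and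
  **`b6BlockParam_knit_iff (hd : 2 ≤ d) (hL : Odd L ∧ 1 < L) (ha : 0 < a) (hδ : 0 < δ₀) :
  B6BlockParam (knitBlock d L a δ₀ Gp) ↔ Prop22Printed (blockGeo d L a) Gp`**; `mainResults_knit`.

## HONEST SCOPE ∕ NOT CLAIMED

ONE LEVEL ONLY, scalar model (U = 1), torus — exactly the scope of `B6MainResultsOneLevel` (all sites at scale K, every prefactor
`(L^jη)^{…} = 1`, d(y, y′) = the ℓ¹ unit-lattice distance of base points, `R = M = 1`, `Hyp21_22 := True`); the genuinely multi-level
statements remain the DAG hypotheses.  Lemma 2.1 at one level carries NO multi-scale content ((2.60) void; its content in print is the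
uniformity of c₁ over all scales and domains — here only uniformity in the volume and K); the bounds are proved for EVERY α > 0 without
using (2.59), which at `R = M = 1` restricts (α, δ₀) only.  The site kernels of Props. 2.3/2.7 are indexed by bonds and read through the base
points (the print's (2.87) kernel is indexed by sites y, y′ ∈ 𝔅: the reading is the pull-back along `(y, μ) ↦ y`, equivalent to the printed
bound).  `B6BlockParam` itself is NOT inhabited: its Prop. 2.2 conjunct (the scalar `G′ = Δ′_a⁻¹` of (2.13)–(2.14), a = 1, seen through the
six functionals (2.67) on test functions and cut-offs) is proved in the tree on ANOTHER one-scale geometry of record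
(`B6Prop22OneScaleTorus.oneScaleGeo`: `Loc` = P-tower multiplets `Fin P.d → Site P 0 → ℝ`, `prop22Printed_oneScaleTorus`), whose transport to
`blockGeo` (`Loc` = famG's located lattice fields) needs the `Loc`/cut-off/Hölder dictionary between the famG lattice calculus and the P-tower
calculus — bookkeeping left open and named exactly by the `iff`.  `B6.StatedBlock` (Lemma 2.1 with the literal c₁(α)) is not claimed.
Constants ours and crude.  Value = the DAG leaf `b6` located EXACTLY on one family of model carriers (seven conjuncts discharged, one named);
NOT summit progress.
-/

namespace Literature.MathematicalPhysics.QuantumFieldTheory.Balaban1983to89.B6BlockParamOneLevel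

open Literature.MathematicalPhysics.QuantumFieldTheory.Balaban1983to89.B6 (Geometry GFamily HFamily BlockData Lemma24Printed Prop22Printed
  Prop23Printed Prop25Printed Prop26Printed Prop27Printed Cor28Printed)
open B6MainResultsOneLevel (blockGeo blockG blockH blockGeo_len rateH oneLevelBlock prop26Printed_block cor28Printed_block)
open B6Prop26OneScaleFromB5 (dist1_le)
open B5ResidualGpTorusHolds (TopIdx)
open B5SiteBridgeP12 (nP MP one_le_nP)
open B5Prop11Plancherel (Tor)
open B5Prop12FieldsLattice (distSite)
open B5RowSumsP12Lattice (rowSum_univ_distSite_le)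
open B4Sect5Proof (latticeConst latticeConst_nonneg)
open B4TorusKernel (periodConst)
open B4TorusKernel.MultiPeriod (torusSupNorm)
open B6RandomWalk (Ineq260)
open B6Lemma21Repaired (Ineq261With)
open B6Lemma24Carrier (carrier q1Of)
open B6Lemma24Printed (lemma24Printed_carrier)
open DagBinding (B6Lemma21Param B6BlockParam B6BlockRest)
open B5Block118 (QvOp)
open B5DeltaA169 (QvAdj DeltaA)
open B5Hk163Strip (kappa163 kappa163_pos)
open B5Hk163TorusHolderDecay (CdecD CdecD_nonneg)
open B5Ineq110P12Lattice (distSite_eq_torusSupNorm)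
open B6LowerBound2153Torus (rep)
open B6Prop27OneScaleTorus (C27 qgqInvKer abs_qgqInvKer_le)
open B6Cor28OneScaleTorus (pv)
open B5Torus145Decay (torusKernel145M inverse145_torusKernelM_decay_torusMetric)
open B5QGGQ145Bounds (kerRe)
open B5RowSumsP12Lattice (chartSite)

open scoped BigOperators
open Finset

noncomputable section

/-! ## §1. Lemma 2.1 at one level: (2.60) is void, (2.61) is a unit-lattice row sum over bonds -/

section RowSum

variable {D : ℕ} (M : Fin D → ℕ) [hM : ∀ μ, NeZero (M μ)]

omit hM in
/-- ℓ^∞ ≤ ℓ¹ on the torus: `distSite ≤ dist1`. [cite: Balaban1984PropagatorsII, p.223 (l¹ distance); Balaban1984PropagatorsI, (1.110) p.35 (sup distance)] -/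
theorem distSite_le_dist1 (y y' : Tor M) : distSite M y y' ≤ B6Prop26OneScaleFromB5.dist1 M y y' := by
  unfold distSite B6Prop26OneScaleFromB5.dist1
  have h : (Finset.univ.sup fun μ => ((y μ - y' μ).valMinAbs).natAbs) ≤ ∑ μ, ((y μ - y' μ).valMinAbs).natAbs :=
    Finset.sup_le fun μ hμ => Finset.single_le_sum (f := fun μ => ((y μ - y' μ).valMinAbs).natAbs) (fun _ _ => Nat.zero_le _) hμ
  exact_mod_cast h

/-- **the one-level row sum over BONDS**: `Σ_{c ∈ T₁ × B} e^{−κ|y − c₋|₁} ≤ |B|·K_D(κ)`, uniformly in the torus (r02's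
`rowSum_univ_distSite_le` through `distSite ≤ dist1`). [cite: Balaban1984PropagatorsII, (2.61) p.234 (one level); Balaban1984PropagatorsI, (1.115)–(1.117) p.36] -/
theorem rowSum_bond_le {κ : ℝ} (hκ : 0 < κ) (B : Type) [Fintype B] (y : Tor M × B) :
    ∑ c : Tor M × B, Real.exp (-(κ * B6Prop26OneScaleFromB5.dist1 M y.1 c.1)) ≤ Fintype.card B * latticeConst D κ := by
  have h1 : ∀ c : Tor M × B, Real.exp (-(κ * B6Prop26OneScaleFromB5.dist1 M y.1 c.1)) ≤ Real.exp (-(κ * distSite M y.1 c.1)) :=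
    fun c => Real.exp_le_exp.mpr (neg_le_neg (mul_le_mul_of_nonneg_left (distSite_le_dist1 M y.1 c.1) hκ.le))
  calc ∑ c : Tor M × B, Real.exp (-(κ * B6Prop26OneScaleFromB5.dist1 M y.1 c.1))
      ≤ ∑ c : Tor M × B, Real.exp (-(κ * distSite M y.1 c.1)) := Finset.sum_le_sum fun c _ => h1 c
    _ = ∑ _b : B, ∑ x : Tor M, Real.exp (-(κ * distSite M y.1 x)) := by rw [Fintype.sum_prod_type_right]
    _ ≤ ∑ _b : B, latticeConst D κ := Finset.sum_le_sum fun _ _ => rowSum_univ_distSite_le M hκ y.1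
    _ = Fintype.card B * latticeConst D κ := by rw [Finset.sum_const, Finset.card_univ, nsmul_eq_mul]

omit hM in
/-- the exponent conversion `e^{−κ|·|_∞} ≤ e^{−(κ/D)|·|₁}` (`|·|₁ ≤ D|·|_∞`, r03 g9's `dist1_le`). [folklore] -/
private theorem exp_rate_le_gen {κ : ℝ} (hκ : 0 ≤ κ) (hD : D ≠ 0) (y c : Tor M) :
    Real.exp (-(κ * distSite M y c)) ≤ Real.exp (-(κ / D * B6Prop26OneScaleFromB5.dist1 M y c)) := by
  apply Real.exp_le_exp.mpr
  have hDpos : (0 : ℝ) < D := by exact_mod_cast Nat.pos_of_ne_zero hD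
  have h := dist1_le M y c
  rw [neg_le_neg_iff, div_mul_eq_mul_div, div_le_iff₀ hDpos]
  calc κ * B6Prop26OneScaleFromB5.dist1 M y c ≤ κ * ((D : ℝ) * distSite M y c) := mul_le_mul_of_nonneg_left h hκ
    _ = κ * distSite M y c * D := by ring

end RowSum

section Lemma21

variable (d L : ℕ) (a : ℝ)

/-- **(2.60) at one level is void**: all sites of the block geometry are at scale `K`, so the right-hand side of (2.60) is
`e⁰ = 1 ≥ e^{−αδ₀d(y,y′)}` (`α, δ₀ ≥ 0`). [cite: Balaban1984PropagatorsII, Lemma 2.1 (2.60) p.234] -/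
theorem ineq260_block (i : TopIdx d L) {δ₀ α : ℝ} (hδ : 0 ≤ δ₀) (hα : 0 ≤ α) : Ineq260 (blockGeo d L a i) δ₀ α := by
  intro y y'
  refine Real.exp_le_exp.mpr (neg_le_neg ?_)
  have hscale : ((blockGeo d L a i).scale y : ℝ) - (blockGeo d L a i).scale y' = 0 := by
    show ((i.P.K : ℕ) : ℝ) - ((i.P.K : ℕ) : ℝ) = 0
    exact sub_self _
  rw [hscale, abs_zero, zero_sub, max_eq_right (by norm_num : (-1 : ℝ) ≤ 0), mul_zero]
  have hdist : 0 ≤ (blockGeo d L a i).dist y y' := by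
    show 0 ≤ B6Prop26OneScaleFromB5.dist1 (MP i.P) y.1 y'.1
    unfold B6Prop26OneScaleFromB5.dist1
    exact Finset.sum_nonneg fun _ _ => Nat.cast_nonneg _
  exact mul_nonneg (mul_nonneg hα hδ) hdist

/-- **(2.61) at one level with the constant `d·K_d(αδ₀)`** (r02's unit-lattice row-sum constant `B4Sect5Proof.latticeConst`, the sites
replaced by bonds contributing the factor `d`), uniformly in the volume and the scale. [cite: Balaban1984PropagatorsII, Lemma 2.1 (2.61) p.234 (one level; constant ours)] -/
theorem ineq261With_block (i : TopIdx d L) {δ₀ α : ℝ} (h : 0 < α * δ₀) :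
    Ineq261With (d * latticeConst d (α * δ₀)) (blockGeo d L a i) δ₀ α := by
  intro y
  have key := rowSum_bond_le (MP i.P) h (Fin i.P.d) y
  rw [Fintype.card_fin] at key
  have hc : ((i.P.d : ℕ) : ℝ) * latticeConst i.P.d (α * δ₀) = (d : ℝ) * latticeConst d (α * δ₀) := by rw [i.hPd]
  rw [hc] at key
  exact key

/-- **Lemma 2.1 in PARAMETER form (`DagBinding.B6Lemma21Param`) on the one-level block**, for every `δ₀ > 0` and WHATEVER the other
carriers: witness `c₁(α) = d·K_d(αδ₀)`; (2.60) void, (2.61) the bond row sum — proved for EVERY `0 < α` WITHOUT using (2.1)–(2.2) or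
(2.59) (one level: `R = M = 1`). [cite: Balaban1984PropagatorsII, Lemma 2.1 (2.60)–(2.61) p.234 (one level; constant ours)] -/
theorem lemma21Param_oneLevel {δ₀ : ℝ} (hδ : 0 < δ₀) (Gp : ∀ i : TopIdx d L, B6.GpFamily (blockGeo d L a i))
    (Cinv Qinv : ∀ i : TopIdx d L, B6.SiteKernel (blockGeo d L a i)) (J : Type) (tree : J → B6.TreeData) (K : Type)
    (loc : K → B6.LocalOp) : B6Lemma21Param (oneLevelBlock d L a δ₀ Gp Cinv Qinv J tree K loc) :=
  ⟨fun α => d * latticeConst d (α * δ₀), fun i _ _ hα0 _ _ =>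
    ⟨ineq260_block d L a i hδ.le hα0.le, ineq261With_block d L a i (mul_pos hα0 hδ)⟩⟩

end Lemma21

/-! ## §2. Proposition 2.7 on the block geometry: p01's genuine `(Q_KΔ_a⁻¹Q_K*)⁻¹` kernel estimate restated for the tori of record -/

section QGQInv

variable {D : ℕ} (M : Fin D → ℕ) [hM : ∀ μ, NeZero (M μ)] (Lb : ℕ) [NeZero Lb] (k : ℕ)

/-- `0 ≤ C₂₇`. [folklore] -/
private theorem C27_nonneg' (d : ℕ) : 0 ≤ C27 d := by
  unfold C27
  have h1 := CdecD_nonneg (d := d)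
  have h2 : 0 ≤ latticeConst (d + 1) (kappa163 (d + 1) / (d + 1) / 2) :=
    latticeConst_nonneg _ (by have := kappa163_pos (d + 1); positivity)
  positivity

/-- **p01's estimate (2.149) on one scale, for an arbitrary positive period vector** (dimension-generic wrapper of
`B6Prop27OneScaleTorus.abs_qgqInvKer_le`: `|(Q_kΔ_a⁻¹Q_k*)⁻¹(b, b′)| ≤ (a + C₂₇)·e^{−(rateH D/2)|y − y′|_∞}`).
[cite: Balaban1984PropagatorsII, Prop. 2.7 (2.149) p.249 (one scale; constants ours)] -/
theorem abs_qgqInv_re_le_gen (hD : D ≠ 0) {a : ℝ} (ha : 0 < a) (b b' : Tor M × Fin D) :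
    |((QvOp (Lb ^ k) M * (DeltaA (Lb ^ k) M a)⁻¹ * QvAdj (Lb ^ k) M)⁻¹ b b').re| ≤
      (a + C27 (D - 1)) * Real.exp (-(rateH D / 2 * distSite M b.1 b'.1)) := by
  obtain ⟨d, rfl⟩ := Nat.exists_eq_succ_of_ne_zero hD
  have hpos : ∀ μ, 0 < M μ := fun μ => Nat.pos_of_ne_zero (NeZero.ne _)
  let M' : Fin (d + 1) → ℕ+ := fun μ => ⟨M μ, hpos μ⟩
  have h := abs_qgqInvKer_le d Lb k M' 1 1 ha b b'
  have e1 : (qgqInvKer d Lb k M' 1 1 a).ker b b' =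
      ((QvOp (Lb ^ k) M * (DeltaA (Lb ^ k) M a)⁻¹ * QvAdj (Lb ^ k) M)⁻¹ b b').re := rfl
  have e2 : torusSupNorm (pv M') (rep (pv M') b.1 - rep (pv M') b'.1) = distSite M b.1 b'.1 :=
    (distSite_eq_torusSupNorm M b.1 b'.1).symm
  rw [e1, e2] at h
  have e3 : d + 1 - 1 = d := Nat.add_sub_cancel d 1
  rw [e3, rateH]
  push_cast
  exact h

end QGQInv

section Prop27

variable (d L : ℕ) (a : ℝ)

/-- **the kernel of `(QGQ*)⁻¹ = (Q_KΔ_a⁻¹Q_K*)⁻¹` on member `i`** (the SAME `G = Δ_a⁻¹ = (B5DeltaA169.DeltaA (nP P) (MP P) a)⁻¹` as the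
block's `G`- and `H`-functionals, cf. `B6MainResultsOneLevel.blockH_operator_eq`), its real entries (`B6Prop27OneScaleTorus.qgqInvKer_coe`:
the entries are real). [cite: Balaban1984PropagatorsII, Prop. 2.7 (2.149) p.249; p.248 («The operator QGQ* is positive, hence the inverse is well defined»)] -/
def blockQinv (i : TopIdx d L) : B6.SiteKernel (blockGeo d L a i) :=
  ⟨fun b b' => ((QvOp (nP i.P) (MP i.P) * (DeltaA (nP i.P) (MP i.P) a)⁻¹ * QvAdj (nP i.P) (MP i.P))⁻¹ b b').re⟩

/-- **PROPOSITION 2.7 (2.149), VERBATIM (`B6.Prop27Printed`), ON THE BLOCK FAMILY** (every `d ≥ 1`, `L`, `a > 0`): witnesses `M₁ = 1`,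
`δ₄ = rateH d / d`, `O(1) = a + C₂₇(d − 1)`; the estimate is p01's `abs_qgqInvKer_le` for the genuine operator, BY NAME.
[cite: Balaban1984PropagatorsII, Prop. 2.7 (2.149) p.249 (one level; constants ours)] -/
theorem prop27Printed_block (hd : 1 ≤ d) (ha : 0 < a) : Prop27Printed d (blockGeo d L a) (blockQinv d L a) := by
  refine ⟨1, rateH d / d, a + C27 (d - 1), one_pos, div_pos (div_pos (kappa163_pos d) (by exact_mod_cast hd)) (by exact_mod_cast hd),
    by have := C27_nonneg' (d - 1); linarith, fun i _ _ b b' => ?_⟩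
  have hD : i.P.d ≠ 0 := by have := i.P.hd; omega
  haveI : NeZero i.P.L := ⟨by have := i.P.hL.2; omega⟩
  rw [blockGeo_len, blockGeo_len, Real.one_rpow, Real.one_rpow, mul_one, mul_one]
  have h := abs_qgqInv_re_le_gen (MP i.P) i.P.L i.P.K hD ha b b'
  have hC : C27 (i.P.d - 1) = C27 (d - 1) := by rw [i.hPd]
  have hr : rateH i.P.d = rateH d := by rw [i.hPd]
  rw [hC, hr] at h
  refine h.trans (mul_le_mul_of_nonneg_left ?_ (by have := C27_nonneg' (d - 1); linarith))
  have hr0 : 0 ≤ rateH d / 2 := by have := kappa163_pos d; unfold rateH; positivity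
  have h2 := exp_rate_le_gen (MP i.P) hr0 hD b.1 b'.1
  have e : rateH d / 2 / (i.P.d : ℕ) = rateH d / d / 2 := by rw [i.hPd]; ring
  rw [e] at h2
  exact h2

end Prop27

/-! ## §3. Proposition 2.3 on the block geometry: [4]'s (1.45) kernel of `(Q′_KG′_K²Q′_K*)⁻¹`, the b05 engine by name -/

section Cinv

/-- the `(Q′_kG′_k²Q′_k*)⁻¹` kernel of [4] (1.45) (`B5Torus145Decay.torusKernel145M`, = p01's `B5QGGQ145Bounds.kerRe` entry) as a real
function of the representative difference, for a period vector of any dimension (0 in dimension 0, where there is no torus).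
[cite: Balaban1984PropagatorsII, Prop. 2.3 (2.87) p.238; Balaban1984PropagatorsI, (1.45) p.26] -/
def cinvFun {D : ℕ} (n : ℕ) [NeZero n] (a : ℝ) : (Fin D → ℕ) → (Fin D → ℤ) → ℝ :=
  match D with
  | 0 => fun _ _ => 0
  | _ + 1 => fun N x => (torusKernel145M n a N x).re

/-- `0 < Λ_κ`. [folklore] -/
private theorem periodConst_pos' {κ : ℝ} (hκ : 0 < κ) (d : ℕ) : 0 < periodConst κ d := by
  unfold periodConst
  have h1 : 0 < κ / (d + 1) := div_pos hκ (by positivity)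
  have h2 : Real.exp (-(κ / (d + 1))) < 1 := Real.exp_lt_one_iff.mpr (by linarith)
  have h3 : 0 < 1 - Real.exp (-(κ / (d + 1))) := by linarith
  positivity

/-- **the (1.45) estimate for an arbitrary positive period vector, in B6's ℓ¹ distance** (dimension-generic wrapper of the b05 engine
`inverse145_torusKernelM_decay_torusMetric`: decay in `|·|_∞ = distSite`, then `|·|₁ ≤ D|·|_∞`).
[cite: Balaban1984PropagatorsII, Prop. 2.3 (2.87) p.238 (one scale; constants ours); Balaban1984PropagatorsI, (1.45) p.26] -/
theorem abs_cinvFun_le_gen {d' : ℕ} {aminus aplus κ c : ℝ} (hκ : 0 ≤ κ)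
    (hdec : ∀ (n : ℕ) [NeZero n] (a : ℝ), aminus ≤ a → a ≤ aplus →
      ∀ N : Fin (d' + 1) → ℕ, (∀ i, 1 ≤ N i) → ∀ x : Fin (d' + 1) → ℤ,
        ‖torusKernel145M n a N x‖ ≤ c⁻¹ * periodConst κ d' * Real.exp (-(κ / (d' + 1) * torusSupNorm N x)))
    {D : ℕ} (hD : D = d' + 1) (M : Fin D → ℕ) [∀ μ, NeZero (M μ)] (n : ℕ) [NeZero n] {a : ℝ} (ha1 : aminus ≤ a)
    (ha2 : a ≤ aplus) (hc : 0 ≤ c⁻¹ * periodConst κ d') (y y' : Tor M) :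
    |cinvFun n a M (rep M y - rep M y')| ≤
      c⁻¹ * periodConst κ d' * Real.exp (-(κ / (d' + 1) / D * B6Prop26OneScaleFromB5.dist1 M y y')) := by
  subst hD
  have hN : ∀ μ, 1 ≤ M μ := fun μ => Nat.one_le_iff_ne_zero.mpr (NeZero.ne _)
  have hB := hdec n a ha1 ha2 M hN (rep M y - rep M y')
  rw [← distSite_eq_torusSupNorm] at hB
  have hre : |cinvFun n a M (rep M y - rep M y')| ≤ ‖torusKernel145M n a M (rep M y - rep M y')‖ :=
    Complex.abs_re_le_norm _
  refine hre.trans (hB.trans (mul_le_mul_of_nonneg_left ?_ hc))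
  have hκ' : 0 ≤ κ / ((d' : ℝ) + 1) := div_nonneg hκ (by positivity)
  have h := exp_rate_le_gen M hκ' (Nat.succ_ne_zero d') y y'
  push_cast at h ⊢
  exact h

/-- **certification**: the entries of `cinvFun` at the box representatives of two unit-torus points ARE p01's matrix entries
`B5QGGQ145Bounds.kerRe` (through r02's chart `chartSite : Tor M → Π_μ Fin M_μ`), i.e. — by `B6Prop23OneScaleTorus.torusCinv_eq_inv` — the
entries of the INVERSE MATRIX of the concrete `Q′_kG′_k²Q′_k*` (definitional). [cite: Balaban1984PropagatorsII, Prop. 2.3 (2.86)–(2.87) p.238; Balaban1984PropagatorsI, (1.45) p.26] -/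
theorem cinvFun_eq_kerRe {d' : ℕ} (M : Fin (d' + 1) → ℕ) [∀ μ, NeZero (M μ)] (n : ℕ) [NeZero n] (a : ℝ) (y y' : Tor M) :
    cinvFun n a M (rep M y - rep M y') = kerRe n a M (chartSite M y) (chartSite M y') := rfl

variable (d L : ℕ) (a : ℝ)

/-- **the kernel of `(Q′G′²Q′*)⁻¹ = (Q′_KG′_K²Q′_K*)⁻¹` on member `i`** (`G′_K = (Δ^η + aQ′_K*Q′_K)⁻¹` on the scalar functions of the
fine torus `T_η`, `η = L^{−K}`, unit torus `T₁^{(K)} = Π_μ ℤ/(MP P)_μ`), indexed by bonds and read through their base points.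
[cite: Balaban1984PropagatorsII, Prop. 2.3 (2.86)–(2.87) p.238; Balaban1984PropagatorsI, (1.45) p.26] -/
def blockCinv (i : TopIdx d L) : B6.SiteKernel (blockGeo d L a i) :=
  ⟨fun y c => cinvFun (nP i.P) a (MP i.P) (rep (MP i.P) y.1 - rep (MP i.P) c.1)⟩

/-- **PROPOSITION 2.3 (2.87), VERBATIM (`B6.Prop23Printed`), ON THE BLOCK FAMILY** (every `d ≥ 1`, `L`, `a > 0`): witnesses `M₁ = 1`,
`δ₁ = 2κ/d²`, `O(1) = c⁻¹Λ_κ(d−1)` with `κ, c` of the b05 engine at the window `[a, a]`; `(L^jη)^{−4}(L^{j′}η)^{−d} = 1` on one level.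
[cite: Balaban1984PropagatorsII, Prop. 2.3 (2.86)–(2.87) p.238 (one level; constants ours)] -/
theorem prop23Printed_block (hd : 1 ≤ d) (ha : 0 < a) : Prop23Printed d (blockGeo d L a) (blockCinv d L a) := by
  obtain ⟨κ, c, hκ, hc, hdec⟩ := inverse145_torusKernelM_decay_torusMetric (d - 1) a a ha
  have hd' : d = d - 1 + 1 := (Nat.sub_add_cancel hd).symm
  have hC : 0 < c⁻¹ * periodConst κ (d - 1) := mul_pos (inv_pos.mpr hc) (periodConst_pos' hκ (d - 1))
  have hdR : ((d - 1 : ℕ) : ℝ) + 1 = d := by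
    rw [Nat.cast_pred hd]; ring
  refine ⟨1, 2 * (κ / d / d), c⁻¹ * periodConst κ (d - 1), one_pos, by positivity, hC, fun i _ _ y y' => ?_⟩
  rw [blockGeo_len, blockGeo_len, Real.one_rpow, Real.one_rpow, mul_one, mul_one]
  have h := abs_cinvFun_le_gen hκ.le hdec (i.hPd.trans hd') (MP i.P) (nP i.P) le_rfl le_rfl hC.le y.1 y'.1
  rw [hdR] at h
  have e2 : κ / (d : ℝ) / ((i.P.d : ℕ) : ℝ) = κ / d / d := by rw [i.hPd]
  rw [e2] at h
  have e : 2 * (κ / d / d) / 2 = κ / d / d := by ring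
  rw [e]
  exact h

end Cinv

/-! ## §4. The knit block: leaf `b6` on the one-level model carriers reduces to its Proposition 2.2 conjunct -/

section Knit

variable (d L : ℕ) (a : ℝ)

/-- the index of the tree-gauge carriers of record: all finite `Λ′ ⊂ Lℤ^d` (`B6Lemma24Carrier.carrier`). [cite: Balaban1984PropagatorsII, Lemma 2.4 p.245 («Let a set Λ ⊂ Z^d be a sum of blocks, Λ = B(Λ′)»)] -/
def TreeIdx : Type := {Λ' : Finset (Fin d → ℤ) // ∀ y ∈ Λ', ∀ j, (L : ℤ) ∣ y j}

/-- **the knit block**: the one-level block bundle of `B6MainResultsOneLevel` (geometries `blockGeo`, `G = Δ_a⁻¹` functionals `blockG`,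
`H = GQ*(QGQ*)⁻¹` functionals `blockH`) with the genuine kernels `Cinv := blockCinv` (`(Q′G′²Q′*)⁻¹`), `Qinv := blockQinv` (`(QGQ*)⁻¹`),
the tree-gauge carriers of `B6Lemma24Carrier` (index `TreeIdx`) and the local operators of `B6Prop25OneLevelV1.loc` (index `Idx d L`);
`δ₀` and the (2.67) functionals `Gp` of `G′` are PARAMETERS. [cite: Balaban1984PropagatorsII, pp.223–250 (the carriers of `B6.BlockData`)] -/
def knitBlock (δ₀ : ℝ) (Gp : ∀ i : TopIdx d L, B6.GpFamily (blockGeo d L a i)) : BlockData :=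
  oneLevelBlock d L a δ₀ Gp (blockCinv d L a) (blockQinv d L a) (TreeIdx d L) (fun t => carrier L t.1 (q1Of L t.1))
    (B6Prop25OneLevelV1.Idx d L) (B6Prop25OneLevelV1.loc d L a)

/-- Lemma 2.4 WITH THE PRINTED CONSTANT holds for the knit block's trees (b06's `lemma24Printed_carrier`, every `d ≥ 2`, `L ≥ 1`).
[cite: Balaban1984PropagatorsII, Lemma 2.4 (2.128) p.245] -/
theorem lemma24Printed_knit (hd : 2 ≤ d) (hL : 1 ≤ L) (δ₀ : ℝ) (Gp : ∀ i : TopIdx d L, B6.GpFamily (blockGeo d L a i)) :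
    Lemma24Printed (knitBlock d L a δ₀ Gp).d (knitBlock d L a δ₀ Gp).L (knitBlock d L a δ₀ Gp).tree :=
  lemma24Printed_carrier hd hL (fun t : TreeIdx d L => t.1) fun t => t.2

/-- Prop. 2.5 holds for the knit block's local operators (r03 g10's `prop25Printed_oneLevel`). [cite: Balaban1984PropagatorsII, Prop. 2.5 p.246] -/
theorem prop25Printed_knit (ha : 0 < a) (δ₀ : ℝ) (Gp : ∀ i : TopIdx d L, B6.GpFamily (blockGeo d L a i)) :
    Prop25Printed (knitBlock d L a δ₀ Gp).loc :=
  B6Prop25OneLevelV1.prop25Printed_oneLevel d L ha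

/-- **the seven discharged conjuncts of the leaf on the knit block**, as one conjunction (Lemma 2.1-param ∧ Prop. 2.3 ∧ Lemma 2.4 ∧
Prop. 2.5 ∧ Prop. 2.6 ∧ Prop. 2.7 ∧ Cor. 2.8), for every `d ≥ 2`, odd `L > 1`, `a > 0`, `δ₀ > 0` and every `Gp`.
[cite: Balaban1984PropagatorsII, Lemma 2.1 p.234, Prop. 2.3 p.238, Lemma 2.4 p.245, Prop. 2.5 p.246, Prop. 2.6 p.247, Prop. 2.7 p.249, Cor. 2.8 p.249] -/
theorem seven_of_eight_knit (hd : 2 ≤ d) (hL : Odd L ∧ 1 < L) (ha : 0 < a) {δ₀ : ℝ} (hδ : 0 < δ₀)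
    (Gp : ∀ i : TopIdx d L, B6.GpFamily (blockGeo d L a i)) :
    B6Lemma21Param (knitBlock d L a δ₀ Gp) ∧ Prop23Printed d (blockGeo d L a) (blockCinv d L a) ∧
      Lemma24Printed (knitBlock d L a δ₀ Gp).d (knitBlock d L a δ₀ Gp).L (knitBlock d L a δ₀ Gp).tree ∧
      Prop25Printed (knitBlock d L a δ₀ Gp).loc ∧ Prop26Printed (blockGeo d L a) (blockG d L a) ∧
      Prop27Printed d (blockGeo d L a) (blockQinv d L a) ∧ Cor28Printed d (blockGeo d L a) (blockH d L a) :=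
  have hd1 : 1 ≤ d := le_trans one_le_two hd
  ⟨lemma21Param_oneLevel d L a hδ Gp _ _ _ _ _ _, prop23Printed_block d L a hd1 ha, lemma24Printed_knit d L a hd (le_of_lt hL.2) δ₀ Gp,
    prop25Printed_knit d L a ha δ₀ Gp, prop26Printed_block d L a hd1 hL ha, prop27Printed_block d L a hd1 ha,
    cor28Printed_block d L a hd1⟩

/-- **LEAF `b6` ON THE ONE-LEVEL KNIT BLOCK REDUCES TO ITS PROPOSITION 2.2 CONJUNCT**: `DagBinding.B6BlockParam` (Lemma 2.1 in parameter
form ∧ Props. 2.2, 2.3 ∧ Lemma 2.4 ∧ Props. 2.5, 2.6, 2.7 ∧ Cor. 2.8, verbatim) holds for the knit block IFF its Prop. 2.2 conjunct holds for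
the chosen (2.67) functionals `Gp` — the other seven being theorems (`seven_of_eight_knit`).
[cite: Balaban1984PropagatorsII, pp.223–250 (Lemma 2.1 p.234, Prop. 2.2 p.234, Prop. 2.3 p.238, Lemma 2.4 p.245, Prop. 2.5 p.246, Prop. 2.6 p.247, Prop. 2.7 p.249, Cor. 2.8 p.249)] -/
theorem b6BlockParam_knit_iff (hd : 2 ≤ d) (hL : Odd L ∧ 1 < L) (ha : 0 < a) {δ₀ : ℝ} (hδ : 0 < δ₀)
    (Gp : ∀ i : TopIdx d L, B6.GpFamily (blockGeo d L a i)) :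
    B6BlockParam (knitBlock d L a δ₀ Gp) ↔ Prop22Printed (blockGeo d L a) Gp := by
  obtain ⟨h21, h23, h24, h25, h26, h27, h28⟩ := seven_of_eight_knit d L a hd hL ha hδ Gp
  constructor
  · rintro ⟨-, h22, -⟩
    exact h22
  · intro h22
    exact ⟨h21, h22, h23, h24, h25, h26, h27, h28⟩

/-- hence, on the knit block, **Proposition 2.2 for SOME (2.67) functionals is all that separates the leaf from a model discharge**:
`(∃ Gp, Prop22Printed (blockGeo d L a) Gp) ↔ ∃ Gp, B6BlockParam (knitBlock d L a δ₀ Gp)`. [cite: Balaban1984PropagatorsII, Prop. 2.2 (2.67) p.234, pp.223–250] -/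
theorem exists_b6BlockParam_knit_iff (hd : 2 ≤ d) (hL : Odd L ∧ 1 < L) (ha : 0 < a) {δ₀ : ℝ} (hδ : 0 < δ₀) :
    (∃ Gp : ∀ i : TopIdx d L, B6.GpFamily (blockGeo d L a i), B6BlockParam (knitBlock d L a δ₀ Gp)) ↔
      ∃ Gp : ∀ i : TopIdx d L, B6.GpFamily (blockGeo d L a i), Prop22Printed (blockGeo d L a) Gp :=
  exists_congr fun Gp => b6BlockParam_knit_iff d L a hd hL ha hδ Gp

/-- **the MAIN RESULTS survive the knit** (the knit block is an instance of `oneLevelBlock`; `B6MainResultsOneLevel.mainResults_oneLevel`).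
[cite: Balaban1984PropagatorsII, p.249 («This Corollary and Proposition 2.6 are our main technical results»)] -/
theorem mainResults_knit (hd : 1 ≤ d) (hL : Odd L ∧ 1 < L) (ha : 0 < a) (δ₀ : ℝ)
    (Gp : ∀ i : TopIdx d L, B6.GpFamily (blockGeo d L a i)) : B6.MainResults (knitBlock d L a δ₀ Gp) :=
  B6MainResultsOneLevel.mainResults_oneLevel d L a hd hL ha δ₀ Gp _ _ _ _ _ _

/-- **non-vacuity**: every member of the knit block's geometry family meets the hypotheses of the eight statements with the witness
`M₁ = 1` ((2.1)–(2.2) void, `M = 1`), and the family is inhabited (`B6Prop26OneScaleFromB5.topIdx_nonempty`). [cite: Balaban1984PropagatorsII, (2.1)–(2.2) p.224] -/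
theorem knit_meets_hypotheses (δ₀ : ℝ) (Gp : ∀ i : TopIdx d L, B6.GpFamily (blockGeo d L a i)) (i : TopIdx d L) :
    ((knitBlock d L a δ₀ Gp).geo i).Hyp21_22 ∧ (1 : ℝ) ≤ ((knitBlock d L a δ₀ Gp).geo i).M :=
  ⟨trivial, le_rfl⟩

end Knit

end

end Literature.MathematicalPhysics.QuantumFieldTheory.Balaban1983to89.B6BlockParamOneLevel
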